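import Literature.Barriers.ValiantsHypothesis.BDGIL24IsotypicProjectionProofs
import Mathlib.RingTheory.MvPolynomial.WeightedHomogeneous

/-!
# van den Berg–Dutta–Gesmundo–Ikenmeyer–Lysikov 2024, Theorem 1.1 (3) — PROVED
# (`BergEtAl2024.thm_1_1_hwv_holds`)

Discharge of the named fact `BergEtAl2024.thm_1_1_hwv` of `BDGIL24IsotypicNaturalProofs.lean`
(val-lit row vdBDGIL24-A; M. van den Berg, P. Dutta, F. Gesmundo, C. Ikenmeyer, V. Lysikov,
*Algebraic metacomplexity and representation theory*, arXiv:2411.03444, Thm. 1.1 (3),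
[cite: BergEtAl2024, Thm. 1.1 (3), p.4 (PDF p.5)]): for a metapolynomial `Δ` of format
`(δ, d, k)` with `cc(Δ) ≤ s` and every weight `χ`, the projection of `Δ` onto the highest-weight
space of weight `χ` has `cc ≤ C s (k+1)^{2k²} (δd)^{2k³}`; here `C = 6`, and in fact
`cc ≤ (δd+1)^{k²} (s+2)` (`thm_1_1_hwv_sharp`).

## The route

As in the paper (§5.1.3: "the highest weight subspace of weight `λ` is exactly the weight `λ`
subspace of the isotypic component corresponding to `V_λ`, so the projector onto the highest
weight subspace is the composition `H_λ Z_λ`"), the projection is the weight-`χ` part of the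
`χ`-isotypic component — but both pieces are taken from the elementary orbit-span route of
`BDGIL24IsotypicProjectionProofs.lean` (a disclosed substitution for the printed `U(𝔤𝔩_k)` length
bookkeeping):

* the `χ`-isotypic component `y` of `Δ` lies in the span of the translates of the weight-`χ`
  highest-weight vectors of the orbit span `M = span (GL_k · Δ)` (`exists_isotypic_decomposition`);
* the weight projector is Mathlib's LINEAR `weightedHomogeneousComponent (μ ↦ -μ) χ`
  (`weightedHomogeneousComponent_eq_weightPart`: the torus weight of a metamonomial is the
  weighted degree for the weight function `c_μ ↦ -μ`, the dual convention of `coordRep`); on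
  homogeneous metapolynomials of degree `δ` it is a combination of torus translates
  (`weightPart_eq_sum_coordRep` of `BDGIL24WeightProjectionProofs.lean`), so it preserves every
  `GL_k`-stable subspace of such metapolynomials (`weightedHomogeneousComponent_mem_of_stable`);
* hence the weight-`χ` part of a translate `g · v` of a highest-weight vector `v` of weight `χ`
  lies in `span (GL_k · v) = span (U⁻ · v)` (`span_orbit_eq_lowerSpan`) and in `V_χ`, so it is a
  multiple of `v` (`exists_eq_smul_of_mem_lowerSpan_of_mem_weightSpace`,
  `GLHighestWeightIsomorphismProofs.lean`) — a highest-weight vector; by linearity the weight-`χ`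
  part `Δ'` of `y` is a highest-weight vector of weight `χ`
  (`weightedHomogeneousComponent_mem_highestWeightSpace_of_mem_span`);
* `Δ - Δ' = (Δ - y) + (y - Δ')` lies in `(⨆_{χ' ≠ χ} hwSubrep χ') ⊔ (⨆_{χ' ≠ χ} V_{χ'})`, and
  `Δ' ∈ M` has `cc ≤ (δd+1)^{k²} (s+2)` (`affComplexity_le_of_mem_span_orbit`)
  `≤ 6 s (k+1)^{2k²} (δd)^{2k³}` (`orbit_cost_le`; the affine case is free).

Theorem-only file (no definitions; the weight function `μ ↦ -μ` is written inline). Honest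
framing: one discharge of typed literature (net debt −1) by a disclosed route substitution; the
statement is the fact name, unchanged. VP ≠ VNP is NOT proved and nothing here is progress on it.

## References
* [BergEtAl2024] M. van den Berg, P. Dutta, F. Gesmundo, C. Ikenmeyer, V. Lysikov,
  arXiv:2411.03444 (2024): Thm. 1.1 (3), §4 (Claim 4.2, weights of metamonomials), §5.1.3
  (highest weight projectors = `H_λ Z_λ`). Held text `paper:arxiv-2411.03444`, p0005, p0028–p0029.
* [GoodmanWallachGTM255] R. Goodman, N. Wallach, *Symmetry, Representations, and Invariants*,
  Lemma 3.2.2 with Cor. 3.2.3 (`dim V(λ) = 1` in a cyclic highest-weight module).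

## Mathlib and tree
Mathlib: `MvPolynomial.weightedHomogeneousComponent` (`weightedHomogeneousComponent_apply`,
`map_add`/`map_smul`), `Finsupp.weight_apply`, `Submodule.span_induction`, `Submodule.add_mem_sup`.
Tree: `BDGIL24IsotypicProjectionProofs` (`exists_isotypic_decomposition`,
`exists_finset_forall_coordRep_mem_span`, `affComplexity_le_of_mem_span_orbit`,
`span_translates_highestWeight_le(_hwSubrep)`, `span_orbit_le_comap`, `self_mem_span_orbit`,
`orbit_cost_le`), `BDGIL24WeightProjectionProofs` (`weightPart_mem_weightSpace`,
`sub_weightPart_mem`, `weightPart_eq_sum_coordRep`, `occupation_le`), `OrbitClosureWeights`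
(`monWeight`), `GCTObstructions` (`isHomogeneous_coordSubst`), `GLHighestWeightIsomorphismProofs`
(`span_orbit_eq_lowerSpan`, `exists_eq_smul_of_mem_lowerSpan_of_mem_weightSpace`, `lowerSpan`),
`CoordRepRational` (`isRationalRep_coordRep`), `thm_1_1_hwv` (`BDGIL24IsotypicNaturalProofs`).
-/

noncomputable section

open MvPolynomial
open scoped BigOperators

namespace Literature.Barriers.ValiantsHypothesis

namespace BergEtAl2024

open Literature.Computability.AlgebraicComplexity Literature.NumberTheory.DiophantineGeometry

/-! ### The weight projector as a weighted homogeneous component -/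

section WeightProjector

variable {k d : ℕ}

/-- The torus weight `monWeight s` of a metamonomial `c^s` is its weighted degree for the weight
function `μ ↦ -μ` on the metavariables `c_μ` (the dual convention of `coordRep`), so that the
weight-`χ` part of a metapolynomial is Mathlib's `weightedHomogeneousComponent (μ ↦ -μ) χ`.
[cite: BergEtAl2024, §4 (Claim 4.2, weights of metamonomials), p.13 (PDF p.14)] -/
theorem weight_neg_eq_monWeight (s : DegIdx (Fin k) d →₀ ℕ) :
    Finsupp.weight (fun μ : DegIdx (Fin k) d => (fun i : Fin k => -((μ.1 i : ℕ) : ℤ))) s =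
      monWeight s := by
  classical
  funext i
  rw [Finsupp.weight_apply, monWeight_apply, Finsupp.sum, Finset.sum_apply]
  simp only [Pi.smul_apply, nsmul_eq_mul]
  push_cast
  rw [← Finset.sum_neg_distrib]
  exact Finset.sum_congr rfl fun μ _ => by ring

/-- **The weight projector.** The weight-`χ` part `∑_{wt(s) = χ} Δ_s c^s` of a metapolynomial
(the projection of `BDGIL24WeightProjectionProofs`, written there as a filtered sum) is the value
of the LINEAR map `weightedHomogeneousComponent (μ ↦ -μ) χ`.
[cite: BergEtAl2024, Thm. 1.1 (1), p.4 (PDF p.5)] -/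
theorem weightedHomogeneousComponent_eq_weightPart (χ : Weight (Fin k))
    (p : MvPolynomial (DegIdx (Fin k) d) ℂ) :
    weightedHomogeneousComponent (fun μ : DegIdx (Fin k) d => (fun i : Fin k => -((μ.1 i : ℕ) : ℤ)))
        χ p = ∑ s ∈ p.support with monWeight s = χ, monomial s (coeff s p) := by
  classical
  rw [weightedHomogeneousComponent_apply]
  refine Finset.sum_congr ?_ fun _ _ => rfl
  ext s
  simp only [Finset.mem_filter, weight_neg_eq_monWeight]

/-- The weight projector lands in the weight space `V_χ`.
[cite: BergEtAl2024, Thm. 1.1 (1), p.4 (PDF p.5)] -/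
theorem weightedHomogeneousComponent_mem_weightSpace (χ : Weight (Fin k))
    (p : MvPolynomial (DegIdx (Fin k) d) ℂ) :
    weightedHomogeneousComponent (fun μ : DegIdx (Fin k) d => (fun i : Fin k => -((μ.1 i : ℕ) : ℤ)))
        χ p ∈ weightSpace (coordRep (Fin k) ℂ d) χ := by
  rw [weightedHomogeneousComponent_eq_weightPart]
  exact weightPart_mem_weightSpace p χ

/-- The rest `p - p_χ` lies in the sum of the other weight spaces.
[cite: BergEtAl2024, Thm. 1.1 (1), p.4 (PDF p.5)] -/
theorem sub_weightedHomogeneousComponent_mem (χ : Weight (Fin k))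
    (p : MvPolynomial (DegIdx (Fin k) d) ℂ) :
    p - weightedHomogeneousComponent
        (fun μ : DegIdx (Fin k) d => (fun i : Fin k => -((μ.1 i : ℕ) : ℤ))) χ p ∈
      ⨆ χ' ∈ {χ' : Weight (Fin k) | χ' ≠ χ}, weightSpace (coordRep (Fin k) ℂ d) χ' := by
  rw [weightedHomogeneousComponent_eq_weightPart]
  exact sub_weightPart_mem p χ

/-- **The weight projector preserves `GL_k`-stable subspaces of format-`(δ, d, k)`
metapolynomials**: on homogeneous metapolynomials of degree `δ` it is a linear combination of
torus translates (`weightPart_eq_sum_coordRep`, interpolation over the box `{0,…,δd}^k`; for a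
weight outside the box it vanishes).
[cite: BergEtAl2024, Thm. 1.1 (1) (proof technique), p.4 (PDF p.5)] -/
theorem weightedHomogeneousComponent_mem_of_stable {δ : ℕ}
    (N : Submodule ℂ (MvPolynomial (DegIdx (Fin k) d) ℂ))
    (hN : ∀ g : GL (Fin k) ℂ, N ≤ N.comap (coordRep (Fin k) ℂ d g))
    {p : MvPolynomial (DegIdx (Fin k) d) ℂ} (hp : p ∈ N) (hhom : p.IsHomogeneous δ)
    (χ : Weight (Fin k)) :
    weightedHomogeneousComponent (fun μ : DegIdx (Fin k) d => (fun i : Fin k => -((μ.1 i : ℕ) : ℤ)))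
        χ p ∈ N := by
  classical
  rw [weightedHomogeneousComponent_eq_weightPart]
  by_cases hbox : ∃ ν : Fin k → Fin (δ * d + 1), χ = fun i => -((ν i : ℕ) : ℤ)
  · obtain ⟨ν, rfl⟩ := hbox
    have hdet : ∀ J : Fin k → Fin (δ * d + 1),
        (Matrix.diagonal fun i => ((J i : ℕ) : ℂ) + 2).det ≠ 0 := by
      intro J
      rw [Matrix.det_diagonal]
      refine Finset.prod_ne_zero_iff.2 fun i _ => ?_
      have : ((J i : ℕ) : ℂ) + 2 = (((J i : ℕ) + 2 : ℕ) : ℂ) := by push_cast; ring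
      rw [this]
      exact Nat.cast_ne_zero.2 (Nat.succ_ne_zero _)
    rw [weightPart_eq_sum_coordRep p hhom ν hdet]
    exact Submodule.sum_mem _ fun J _ => Submodule.smul_mem _ _ (hN _ hp)
  · have hempty : (p.support.filter fun s' => monWeight s' = χ) = ∅ := by
      refine Finset.filter_eq_empty_iff.2 fun s' hs' hw => hbox ⟨fun i =>
        ⟨∑ μ ∈ s'.support, s' μ * μ.1 i, Nat.lt_succ_of_le (occupation_le hhom hs' i)⟩, ?_⟩
      rw [← hw]
      funext i
      rw [monWeight_apply]
    rw [hempty, Finset.sum_empty]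
    exact Submodule.zero_mem _

/-- Translates of a homogeneous metapolynomial span a space of homogeneous metapolynomials of the
same degree (`GL_k` acts degree-wise).
[cite: BergEtAl2024, §2.5 (proof of Thm. 2.4: "`I(X)_δ` … closed under the action"), p.10 (PDF p.11)] -/
theorem isHomogeneous_of_mem_span_orbit {δ : ℕ} {Δ : MvPolynomial (DegIdx (Fin k) d) ℂ}
    (hΔ : Δ.IsHomogeneous δ) {p : MvPolynomial (DegIdx (Fin k) d) ℂ}
    (hp : p ∈ Submodule.span ℂ (Set.range fun h : GL (Fin k) ℂ => coordRep (Fin k) ℂ d h Δ)) :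
    p.IsHomogeneous δ := by
  have hle : Submodule.span ℂ (Set.range fun h : GL (Fin k) ℂ => coordRep (Fin k) ℂ d h Δ) ≤
      homogeneousSubmodule (DegIdx (Fin k) d) ℂ δ := by
    refine Submodule.span_le.mpr ?_
    rintro _ ⟨g, rfl⟩
    exact (mem_homogeneousSubmodule δ _).mpr (isHomogeneous_coordSubst g hΔ)
  exact (mem_homogeneousSubmodule δ p).mp (hle hp)

/-- **Key step**: the weight-`χ` part of a translate `g · v` of a highest-weight vector `v` of
weight `χ` (homogeneous of degree `δ`) is a multiple of `v`, hence again a highest-weight vector: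
it lies in `span (GL_k · v) = span (U⁻ · v)` (`span_orbit_eq_lowerSpan`), whose weight-`χ`
vectors form the line `ℂ v` (`exists_eq_smul_of_mem_lowerSpan_of_mem_weightSpace`).
[cite: GoodmanWallachGTM255, Lemma 3.2.2 with Cor. 3.2.3] -/
theorem weightedHomogeneousComponent_translate_mem_highestWeightSpace {δ : ℕ}
    {v : MvPolynomial (DegIdx (Fin k) d) ℂ} (hvhom : v.IsHomogeneous δ) {χ : Weight (Fin k)}
    (hv : v ∈ highestWeightSpace (coordRep (Fin k) ℂ d) χ) (g : GL (Fin k) ℂ) :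
    weightedHomogeneousComponent (fun μ : DegIdx (Fin k) d => (fun i : Fin k => -((μ.1 i : ℕ) : ℤ)))
        χ (coordRep (Fin k) ℂ d g v) ∈ highestWeightSpace (coordRep (Fin k) ℂ d) χ := by
  set ρ := coordRep (Fin k) ℂ d with hρ
  set N := Submodule.span ℂ (Set.range fun h : GL (Fin k) ℂ => ρ h v) with hN
  have hNstab : ∀ g', N ≤ N.comap (ρ g') := span_orbit_le_comap v
  have hgv : ρ g v ∈ N := Submodule.subset_span ⟨g, rfl⟩
  have hPN := weightedHomogeneousComponent_mem_of_stable N hNstab hgv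
    (isHomogeneous_of_mem_span_orbit hvhom hgv) χ
  have hPwt := weightedHomogeneousComponent_mem_weightSpace χ (ρ g v)
  have hlow : weightedHomogeneousComponent
      (fun μ : DegIdx (Fin k) d => (fun i : Fin k => -((μ.1 i : ℕ) : ℤ))) χ (ρ g v) ∈
        lowerSpan ρ v := by
    rw [← span_orbit_eq_lowerSpan (isRationalRep_coordRep d) hv]
    exact hPN
  obtain ⟨c, hc⟩ := exists_eq_smul_of_mem_lowerSpan_of_mem_weightSpace (isRationalRep_coordRep d)
    (highestWeightSpace_le_weightSpace _ _ hv) hlow hPwt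
  rw [hc]
  exact Submodule.smul_mem _ c hv

/-- The weight-`χ` part of an element of the span of the translates of the weight-`χ`
highest-weight vectors of a space `M` of homogeneous degree-`δ` metapolynomials is a
highest-weight vector of weight `χ` (linearity of the weight projector and the previous lemma):
"the highest weight subspace of weight `λ` is exactly the weight-`λ` subspace of the isotypic
component". [cite: BergEtAl2024, §5.1.3, p.27 (PDF p.28)] -/
theorem weightedHomogeneousComponent_mem_highestWeightSpace_of_mem_span {δ : ℕ}
    (M : Submodule ℂ (MvPolynomial (DegIdx (Fin k) d) ℂ)) (hMhom : ∀ p ∈ M, p.IsHomogeneous δ)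
    (χ : Weight (Fin k)) {y : MvPolynomial (DegIdx (Fin k) d) ℂ}
    (hy : y ∈ Submodule.span ℂ {z | ∃ (g : GL (Fin k) ℂ) (v : MvPolynomial (DegIdx (Fin k) d) ℂ),
        v ∈ M ∧ v ∈ highestWeightSpace (coordRep (Fin k) ℂ d) χ ∧ z = coordRep (Fin k) ℂ d g v}) :
    weightedHomogeneousComponent (fun μ : DegIdx (Fin k) d => (fun i : Fin k => -((μ.1 i : ℕ) : ℤ)))
        χ y ∈ highestWeightSpace (coordRep (Fin k) ℂ d) χ := by
  induction hy using Submodule.span_induction with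
  | mem z hz =>
    obtain ⟨g, v, hvM, hvχ, rfl⟩ := hz
    exact weightedHomogeneousComponent_translate_mem_highestWeightSpace (hMhom v hvM) hvχ g
  | zero =>
    rw [map_zero]
    exact Submodule.zero_mem _
  | add x y _ _ hx hy =>
    rw [map_add]
    exact Submodule.add_mem _ hx hy
  | smul c x _ hx =>
    rw [map_smul]
    exact Submodule.smul_mem _ c hx

end WeightProjector

/-! ### Theorem 1.1 (3) -/

/-- **van den Berg–Dutta–Gesmundo–Ikenmeyer–Lysikov 2024, Theorem 1.1 (3) holds** (absolute
constant `C = 6`): for a metapolynomial `Δ` of format `(δ, d, k)` with `cc(Δ) ≤ s` and every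
weight `χ`, the projection of `Δ` onto the highest-weight space of weight `χ` — the weight-`χ`
part of its `χ`-isotypic component ("the composition `H_λ Z_λ`", §5.1.3) — has
`cc ≤ 6 s (k+1)^{2k²} (δd)^{2k³}` (indeed `≤ (δd+1)^{k²} (s+2)`, `thm_1_1_hwv_sharp`). Route:
the isotypic component `y` of `Δ` lies in the orbit span `M = span (GL_k · Δ)`
(`exists_isotypic_decomposition`), the weight projector keeps `M` (torus interpolation) and maps
`y` to a highest-weight vector (`weightedHomogeneousComponent_mem_highestWeightSpace_of_mem_span`),
and `M` has dimension `≤ (δd+1)^{k²}` with all elements of `cc ≤ (δd+1)^{k²}(s+2)`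
(`affComplexity_le_of_mem_span_orbit`). Discharge of the named fact `BergEtAl2024.thm_1_1_hwv`.
[cite: BergEtAl2024, Thm. 1.1 (3), p.4 (PDF p.5)] -/
theorem thm_1_1_hwv_holds : thm_1_1_hwv := by
  refine ⟨6, fun δ d k s Δ hd hΔ hs χ => ?_⟩
  classical
  set ρ := coordRep (Fin k) ℂ d with hρ
  set M := Submodule.span ℂ (Set.range fun h : GL (Fin k) ℂ => ρ h Δ) with hM
  have hMstab : ∀ g, M ≤ M.comap (ρ g) := span_orbit_le_comap Δ
  obtain ⟨T, -, hTmem⟩ := exists_finset_forall_coordRep_mem_span Δ hΔ.totalDegree_le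
  have hMT : M ≤ Submodule.span ℂ (T : Set (MvPolynomial (DegIdx (Fin k) d) ℂ)) :=
    Submodule.span_le.mpr (by rintro _ ⟨g, rfl⟩; exact hTmem g)
  haveI : FiniteDimensional ℂ M := Submodule.finiteDimensional_of_le hMT
  have hMhom : ∀ p ∈ M, p.IsHomogeneous δ := fun p hp => isHomogeneous_of_mem_span_orbit hΔ hp
  obtain ⟨y, hy, hxy⟩ := exists_isotypic_decomposition (isRationalRep_coordRep d) M hMstab
    (self_mem_span_orbit Δ) χ
  have hyM : y ∈ M := span_translates_highestWeight_le M hMstab χ hy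
  refine ⟨weightedHomogeneousComponent
      (fun μ : DegIdx (Fin k) d => (fun i : Fin k => -((μ.1 i : ℕ) : ℤ))) χ y,
    weightedHomogeneousComponent_mem_highestWeightSpace_of_mem_span M hMhom χ hy, ?_, ?_⟩
  · have h1 : Δ - y ∈ ⨆ χ' ∈ {χ' : Weight (Fin k) | χ' ≠ χ}, hwSubrep ρ χ' :=
      iSup₂_mono (fun χ' _ => span_translates_highestWeight_le_hwSubrep M χ') hxy
    have h2 := sub_weightedHomogeneousComponent_mem χ y
    have heq : Δ - weightedHomogeneousComponent
        (fun μ : DegIdx (Fin k) d => (fun i : Fin k => -((μ.1 i : ℕ) : ℤ))) χ y =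
        (Δ - y) + (y - weightedHomogeneousComponent
          (fun μ : DegIdx (Fin k) d => (fun i : Fin k => -((μ.1 i : ℕ) : ℤ))) χ y) := by abel
    rw [heq]
    exact Submodule.add_mem_sup h1 h2
  · have hΔ'M := weightedHomogeneousComponent_mem_of_stable M hMstab hyM (hMhom y hyM) χ
    by_cases haff : Δ.totalDegree ≤ 1
    · rw [affComplexity_eq_zero_of_mem_span_of_totalDegree_le_one
        (totalDegree_le_one_of_mem_range_orbit haff) hΔ'M]
      exact Nat.zero_le _
    · have hs1 : 1 ≤ s := by
        by_contra h0
        exact haff (totalDegree_le_one_of_affComplexity_eq_zero (by omega))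
      have hδ : 2 ≤ δ := by
        by_contra h
        exact haff (hΔ.totalDegree_le.trans (by omega))
      refine (affComplexity_le_of_mem_span_orbit hΔ hs hΔ'M).trans ?_
      refine (orbit_cost_le (D := δ * d) (k := k) (by nlinarith) hs1).trans ?_
      gcongr
      exact Nat.le_succ k

/-- **Theorem 1.1 (3), sharp form of this route**: the highest-weight projections of a
metapolynomial of format `(δ, d, k)` with `cc ≤ s` lie in the orbit span and have
`cc ≤ (δd + 1)^{k²} (s + 2)`. [cite: BergEtAl2024, Thm. 1.1 (3), p.4 (PDF p.5)] -/
theorem thm_1_1_hwv_sharp (δ d k s : ℕ) (Δ : MvPolynomial (DegIdx (Fin k) d) ℂ)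
    (hΔ : Δ.IsHomogeneous δ) (hs : affComplexity Δ ≤ s) (χ : Weight (Fin k)) :
    ∃ Δ' : MvPolynomial (DegIdx (Fin k) d) ℂ,
      Δ' ∈ highestWeightSpace (coordRep (Fin k) ℂ d) χ ∧
      Δ - Δ' ∈ (⨆ χ' ∈ {χ' : Weight (Fin k) | χ' ≠ χ}, hwSubrep (coordRep (Fin k) ℂ d) χ') ⊔
        (⨆ χ' ∈ {χ' : Weight (Fin k) | χ' ≠ χ}, weightSpace (coordRep (Fin k) ℂ d) χ') ∧
      Δ' ∈ Submodule.span ℂ (Set.range fun h : GL (Fin k) ℂ => coordRep (Fin k) ℂ d h Δ) ∧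
      affComplexity Δ' ≤ (δ * d + 1) ^ (k * k) * (s + 2) := by
  classical
  set ρ := coordRep (Fin k) ℂ d with hρ
  set M := Submodule.span ℂ (Set.range fun h : GL (Fin k) ℂ => ρ h Δ) with hM
  have hMstab : ∀ g, M ≤ M.comap (ρ g) := span_orbit_le_comap Δ
  obtain ⟨T, -, hTmem⟩ := exists_finset_forall_coordRep_mem_span Δ hΔ.totalDegree_le
  have hMT : M ≤ Submodule.span ℂ (T : Set (MvPolynomial (DegIdx (Fin k) d) ℂ)) :=
    Submodule.span_le.mpr (by rintro _ ⟨g, rfl⟩; exact hTmem g)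
  haveI : FiniteDimensional ℂ M := Submodule.finiteDimensional_of_le hMT
  have hMhom : ∀ p ∈ M, p.IsHomogeneous δ := fun p hp => isHomogeneous_of_mem_span_orbit hΔ hp
  obtain ⟨y, hy, hxy⟩ := exists_isotypic_decomposition (isRationalRep_coordRep d) M hMstab
    (self_mem_span_orbit Δ) χ
  have hyM : y ∈ M := span_translates_highestWeight_le M hMstab χ hy
  have hΔ'M := weightedHomogeneousComponent_mem_of_stable M hMstab hyM (hMhom y hyM) χ
  refine ⟨weightedHomogeneousComponent
      (fun μ : DegIdx (Fin k) d => (fun i : Fin k => -((μ.1 i : ℕ) : ℤ))) χ y,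
    weightedHomogeneousComponent_mem_highestWeightSpace_of_mem_span M hMhom χ hy, ?_, hΔ'M,
    affComplexity_le_of_mem_span_orbit hΔ hs hΔ'M⟩
  have h1 : Δ - y ∈ ⨆ χ' ∈ {χ' : Weight (Fin k) | χ' ≠ χ}, hwSubrep ρ χ' :=
    iSup₂_mono (fun χ' _ => span_translates_highestWeight_le_hwSubrep M χ') hxy
  have h2 := sub_weightedHomogeneousComponent_mem χ y
  have heq : Δ - weightedHomogeneousComponent
      (fun μ : DegIdx (Fin k) d => (fun i : Fin k => -((μ.1 i : ℕ) : ℤ))) χ y =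
      (Δ - y) + (y - weightedHomogeneousComponent
        (fun μ : DegIdx (Fin k) d => (fun i : Fin k => -((μ.1 i : ℕ) : ℤ))) χ y) := by abel
  rw [heq]
  exact Submodule.add_mem_sup h1 h2

end BergEtAl2024

end Literature.Barriers.ValiantsHypothesis

end
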